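import Summits.Langlands.Langlands.Theses.HeckeFieldDeRham
import Literature.FieldTheory.AlgClosed.PadicAlgClEquivComplex

/-!
# BC3 birth skeleton — child `PairCompatibilityModuloDeRham` (LGC°) of the decomposition of
# `HeckeFieldDeRham.ReciprocityModuloDeRham` (stmt-Langlands-17410), crux-strategist gen 1, 2026-08-17

LGC° ⇐ (away-from-`ℓ`, modulo nothing) ∧ (CONDITIONAL PRIME SWITCH at `v ∣ ℓ`) ∧ (W⁺ for the auxiliary `ℓ'`-adic avatar):
the mechanism of route PrimeSwitchSplit (`PadicMemberCompatibility` (ii), Fontaine's `C_WD` for the compatible system of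
avatars) transported MODULO DE RHAM — P(i) "the avatar is de Rham" is moved into the hypothesis, which is exactly the shape
RMD's conditional clause has.  Three named stubs (the ONLY sorries); `PairCompatibilityModuloDeRham_of` kernel-checked.
Until `route edit --split` installs the child decl, the conclusion is the child's TEXT restated here as a `def` in the route
namespace (post-split: delete the `def`, the name then denotes the route decl).
-/

set_option linter.dupNamespace false

namespace Summit.Langlands.Langlands.Theses.HeckeFieldDeRham

open scoped BigOperators Topology Manifold Classical MeasureTheory ProbabilityTheory Matrix InnerProductSpace ComplexConjugate ContinuousMap
open Filter Set Function TopologicalSpace MeasureTheory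

/-- LGC° — the child's text (VERBATIM children.json `PairCompatibilityModuloDeRham`). -/
def PairCompatibilityModuloDeRham : Prop :=
  ∀ (K : Type) [Field K] [NumberField K], ∃ Rec : ReciprocityData K, ∀ (n : ℕ) (hcpt : Literature.NumberTheory.Automorphic.isCompact_glFiniteIntegralLevel n K), 0 < n → ∀ (π : Literature.NumberTheory.Automorphic.CuspidalAutomorphicRepData n K hcpt), π.1.IsLAlgebraic → ∀ (ℓ : ℕ) [Fact ℓ.Prime] (ι : PadicAlgCl ℓ ≃+* ℂ) (ρ : Literature.NumberTheory.GaloisRepresentations.FramedGaloisRep K (PadicAlgCl ℓ) n), ρ.toGaloisRep.IsIrreducible → (∀ᶠ v : IsDedekindDomain.HeightOneSpectrum (NumberField.RingOfIntegers K) in cofinite, SatakeFrobCompatibleAt ι π.1 ρ v) → ∀ v : IsDedekindDomain.HeightOneSpectrum (NumberField.RingOfIntegers K), (∀ hv : ((ℓ : ℕ) : NumberField.RingOfIntegers K) ∈ v.asIdeal, (Rec.pst ℓ v hv).IsDeRhamFramed (ρ.toLocal v)) → LocalGlobalCompatibleAt Rec ι π.1 ρ v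

namespace Cruxes.PairCompatibilityModuloDeRham.Birth

/-- **stub LGC-away° (OPEN: Taylor 2004 Conj. 7 at `v ∤ ℓ` for IRREDUCIBLE Satake-compatible pairs, one `Rec` per field,
NO geometric hypothesis)** — = `PrimeSwitchSplit.CompatibilityAwayFromL` (stmt-Langlands-17417) / the registered 14328 stub
`stub_pairCompatibilityAway` with the pinned-geometric hypothesis DROPPED (by avatar conjugacy it is still a consequence of the
summit).  Grothendieck–Deligne side: Carayol, Harris–Taylor Thm. A/B, Taylor–Yoshida, Caraiani; Varma 2024 up to monodromy `≺`
for regular `π` over CM.  [cite: HarrisTaylorAMS2001, Thm. A] [cite: VarmaFMS2024, Thm. 1] -/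
theorem stub_awayFromL :
    ∀ (K : Type) [Field K] [NumberField K], ∃ Rec : ReciprocityData K, ∀ (n : ℕ) (hcpt : Literature.NumberTheory.Automorphic.isCompact_glFiniteIntegralLevel n K), 0 < n → ∀ (π : Literature.NumberTheory.Automorphic.CuspidalAutomorphicRepData n K hcpt), π.1.IsLAlgebraic → ∀ (ℓ : ℕ) [Fact ℓ.Prime] (ι : PadicAlgCl ℓ ≃+* ℂ) (ρ : Literature.NumberTheory.GaloisRepresentations.FramedGaloisRep K (PadicAlgCl ℓ) n), ρ.toGaloisRep.IsIrreducible → (∀ᶠ v : IsDedekindDomain.HeightOneSpectrum (NumberField.RingOfIntegers K) in cofinite, SatakeFrobCompatibleAt ι π.1 ρ v) → ∀ v : IsDedekindDomain.HeightOneSpectrum (NumberField.RingOfIntegers K), ((ℓ : ℕ) : NumberField.RingOfIntegers K) ∉ v.asIdeal → LocalGlobalCompatibleAt Rec ι π.1 ρ v := by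
  sorry

/-- **stub CONDITIONAL PRIME SWITCH (OPEN: Fontaine's `C_WD` / strict compatibility at `v ∣ ℓ` for the system of avatars,
for EVERY datum `Rec`)** — = `PrimeSwitchSplit.PadicMemberCompatibility` (stmt-Langlands-17534) clause (ii) with clause (i)
"`ρ|_v` is de Rham" turned into a HYPOTHESIS: if the `ℓ`-adic irreducible avatar `ρ` of `π` is de Rham at `v ∣ ℓ`, then
local–global compatibility at `v` of ANY irreducible `ℓ'`-adic avatar `ρ'` with `ℓ' ∤ v` transfers to `(π, ρ)` at `v` (`Rec`
cancels: both sides name `rec_v(π_v)`; the content is `ι WD(D_pst ρ|_v)^{F-ss} ≅ ι' WD(ρ'|_v)^{F-ss}`).  Known for regular `π`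
over CM semisimplified (A'Campo–Hevesi–Thorne–Whitmore), for Shimura-variety motives (Saito, Caraiani); OPEN in general.
[cite: FontaineAsterisque223VIII, §2.3.7] [cite: HarrisTaylorAMS2001, Thm. A] -/
theorem stub_conditionalPrimeSwitch :
    ∀ (K : Type) [Field K] [NumberField K] (Rec : ReciprocityData K) (n : ℕ) (hcpt : Literature.NumberTheory.Automorphic.isCompact_glFiniteIntegralLevel n K), 0 < n → ∀ (π : Literature.NumberTheory.Automorphic.CuspidalAutomorphicRepData n K hcpt), π.1.IsLAlgebraic → ∀ (ℓ : ℕ) [Fact ℓ.Prime] (ι : PadicAlgCl ℓ ≃+* ℂ) (ρ : Literature.NumberTheory.GaloisRepresentations.FramedGaloisRep K (PadicAlgCl ℓ) n), ρ.toGaloisRep.IsIrreducible → (∀ᶠ v : IsDedekindDomain.HeightOneSpectrum (NumberField.RingOfIntegers K) in cofinite, SatakeFrobCompatibleAt ι π.1 ρ v) → ∀ (v : IsDedekindDomain.HeightOneSpectrum (NumberField.RingOfIntegers K)) (hv : ((ℓ : ℕ) : NumberField.RingOfIntegers K) ∈ v.asIdeal), (Rec.pst ℓ v hv).IsDeRhamFramed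 (ρ.toLocal v) → ∀ (ℓ' : ℕ) [Fact ℓ'.Prime] (ι' : PadicAlgCl ℓ' ≃+* ℂ) (ρ' : Literature.NumberTheory.GaloisRepresentations.FramedGaloisRep K (PadicAlgCl ℓ') n), ((ℓ' : ℕ) : NumberField.RingOfIntegers K) ∉ v.asIdeal → ρ'.toGaloisRep.IsIrreducible → (∀ᶠ w : IsDedekindDomain.HeightOneSpectrum (NumberField.RingOfIntegers K) in cofinite, SatakeFrobCompatibleAt ι' π.1 ρ' w) → LocalGlobalCompatibleAt Rec ι' π.1 ρ' v → LocalGlobalCompatibleAt Rec ι π.1 ρ v := by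
  sorry

/-- **stub W⁺ (OPEN; VERBATIM the sibling child / item stmt-Langlands-17415 `SatakeAvatarExistence`)** — supplies the auxiliary
`ℓ'`-adic avatar the switch reads `v ∣ ℓ` through. [cite: BuzzardGeeLMS2014, Conj. 3.2.2] -/
theorem stub_satakeAvatarExistence :
    ∀ (K : Type) [Field K] [NumberField K] (n : ℕ) (hcpt : Literature.NumberTheory.Automorphic.isCompact_glFiniteIntegralLevel n K), 0 < n → ∀ (π : Literature.NumberTheory.Automorphic.CuspidalAutomorphicRepData n K hcpt), π.1.IsLAlgebraic → ∀ (ℓ : ℕ) [Fact ℓ.Prime] (ι : PadicAlgCl ℓ ≃+* ℂ), ∃ ρ : Literature.NumberTheory.GaloisRepresentations.FramedGaloisRep K (PadicAlgCl ℓ) n, ρ.toGaloisRep.IsIrreducible ∧ ∀ᶠ v : IsDedekindDomain.HeightOneSpectrum (NumberField.RingOfIntegers K) in cofinite, SatakeFrobCompatibleAt ι π.1 ρ v := by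
  sorry

/-- **LGC° from its three stubs** (sorry-free): `Rec` := the datum of LGC-away°; at `v ∤ ℓ` the away stub; at `v ∣ ℓ` pick
`ℓ' ∈ {2, 3}` with `ℓ' ∉ v` (both in `v` would put `1 = 3 - 2` in `v`), `ι' : ℚ̄_(ℓ') ≃+* ℂ`
(`PadicAlgCl.nonempty_ringEquiv_complex`), the `ℓ'`-adic avatar `ρ'` of W⁺, its compatibility at `v` from the away stub
(`v ∤ ℓ'`), and switch it to `(π, ρ)` under the de Rham hypothesis. [cite: BuzzardGeeLMS2014, Conj. 3.2.2] -/
theorem PairCompatibilityModuloDeRham_of :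
    (∀ (K : Type) [Field K] [NumberField K], ∃ Rec : ReciprocityData K, ∀ (n : ℕ) (hcpt : Literature.NumberTheory.Automorphic.isCompact_glFiniteIntegralLevel n K), 0 < n → ∀ (π : Literature.NumberTheory.Automorphic.CuspidalAutomorphicRepData n K hcpt), π.1.IsLAlgebraic → ∀ (ℓ : ℕ) [Fact ℓ.Prime] (ι : PadicAlgCl ℓ ≃+* ℂ) (ρ : Literature.NumberTheory.GaloisRepresentations.FramedGaloisRep K (PadicAlgCl ℓ) n), ρ.toGaloisRep.IsIrreducible → (∀ᶠ v : IsDedekindDomain.HeightOneSpectrum (NumberField.RingOfIntegers K) in cofinite, SatakeFrobCompatibleAt ι π.1 ρ v) → ∀ v : IsDedekindDomain.HeightOneSpectrum (NumberField.RingOfIntegers K), ((ℓ : ℕ) : NumberField.RingOfIntegers K) ∉ v.asIdeal → LocalGlobalCompatibleAt Rec ι π.1 ρ v) →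
    (∀ (K : Type) [Field K] [NumberField K] (Rec : ReciprocityData K) (n : ℕ) (hcpt : Literature.NumberTheory.Automorphic.isCompact_glFiniteIntegralLevel n K), 0 < n → ∀ (π : Literature.NumberTheory.Automorphic.CuspidalAutomorphicRepData n K hcpt), π.1.IsLAlgebraic → ∀ (ℓ : ℕ) [Fact ℓ.Prime] (ι : PadicAlgCl ℓ ≃+* ℂ) (ρ : Literature.NumberTheory.GaloisRepresentations.FramedGaloisRep K (PadicAlgCl ℓ) n), ρ.toGaloisRep.IsIrreducible → (∀ᶠ v : IsDedekindDomain.HeightOneSpectrum (NumberField.RingOfIntegers K) in cofinite, SatakeFrobCompatibleAt ι π.1 ρ v) → ∀ (v : IsDedekindDomain.HeightOneSpectrum (NumberField.RingOfIntegers K)) (hv : ((ℓ : ℕ) : NumberField.RingOfIntegers K) ∈ v.asIdeal), (Rec.pst ℓ v hv).IsDeRhamFramed (ρ.toLocal v) → ∀ (ℓ' : ℕ) [Fact ℓ'.Prime] (ι' : PadicAlgCl ℓ' ≃+* ℂ) (ρ' : Literature.NumberTheory.GaloisRepresentations.FramedGaloisRep K (PadicAlgCl ℓ') n), ((ℓ'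 : ℕ) : NumberField.RingOfIntegers K) ∉ v.asIdeal → ρ'.toGaloisRep.IsIrreducible → (∀ᶠ w : IsDedekindDomain.HeightOneSpectrum (NumberField.RingOfIntegers K) in cofinite, SatakeFrobCompatibleAt ι' π.1 ρ' w) → LocalGlobalCompatibleAt Rec ι' π.1 ρ' v → LocalGlobalCompatibleAt Rec ι π.1 ρ v) →
    (∀ (K : Type) [Field K] [NumberField K] (n : ℕ) (hcpt : Literature.NumberTheory.Automorphic.isCompact_glFiniteIntegralLevel n K), 0 < n → ∀ (π : Literature.NumberTheory.Automorphic.CuspidalAutomorphicRepData n K hcpt), π.1.IsLAlgebraic → ∀ (ℓ : ℕ) [Fact ℓ.Prime] (ι : PadicAlgCl ℓ ≃+* ℂ), ∃ ρ : Literature.NumberTheory.GaloisRepresentations.FramedGaloisRep K (PadicAlgCl ℓ) n, ρ.toGaloisRep.IsIrreducible ∧ ∀ᶠ v : IsDedekindDomain.HeightOneSpectrum (NumberField.RingOfIntegers K) in cofinite, SatakeFrobCompatibleAt ι π.1 ρ v) →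
    PairCompatibilityModuloDeRham := by
  intro hA hS hW K _ _
  obtain ⟨Rec, hRec⟩ := hA K
  refine ⟨Rec, fun n hcpt hn π hπ ℓ _ ι ρ hirr hsat v hdR => ?_⟩
  by_cases hv : ((ℓ : ℕ) : NumberField.RingOfIntegers K) ∈ v.asIdeal
  · -- `v ∣ ℓ`: read `v` through an auxiliary prime `ℓ' ∈ {2, 3}` not below `v`
    have key : ∀ (ℓ' : ℕ) [Fact ℓ'.Prime], ((ℓ' : ℕ) : NumberField.RingOfIntegers K) ∉ v.asIdeal →
        LocalGlobalCompatibleAt Rec ι π.1 ρ v := by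
      intro ℓ' _ hℓ'
      obtain ⟨ι'⟩ := PadicAlgCl.nonempty_ringEquiv_complex ℓ'
      obtain ⟨ρ', hirr', hsat'⟩ := hW K n hcpt hn π hπ ℓ' ι'
      exact hS K Rec n hcpt hn π hπ ℓ ι ρ hirr hsat v hv (hdR hv) ℓ' ι' ρ' hℓ' hirr' hsat'
        (hRec n hcpt hn π hπ ℓ' ι' ρ' hirr' hsat' v hℓ')
    by_cases h2 : ((2 : ℕ) : NumberField.RingOfIntegers K) ∈ v.asIdeal
    · have h3 : ((3 : ℕ) : NumberField.RingOfIntegers K) ∉ v.asIdeal := by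
        intro h3
        apply v.isPrime.ne_top
        rw [Ideal.eq_top_iff_one]
        have h32 : ((3 : ℕ) : NumberField.RingOfIntegers K) - ((2 : ℕ) : NumberField.RingOfIntegers K) = 1 := by
          push_cast; norm_num
        rw [← h32]
        exact v.asIdeal.sub_mem h3 h2
      haveI : Fact (Nat.Prime 3) := ⟨by norm_num⟩
      exact key 3 h3
    · haveI : Fact (Nat.Prime 2) := ⟨by norm_num⟩
      exact key 2 h2
  · exact hRec n hcpt hn π hπ ℓ ι ρ hirr hsat v hv

/-- The child modulo exactly the three stubs. -/
theorem PairCompatibilityModuloDeRham_of_stubs : PairCompatibilityModuloDeRham :=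
  PairCompatibilityModuloDeRham_of stub_awayFromL stub_conditionalPrimeSwitch stub_satakeAvatarExistence

end Cruxes.PairCompatibilityModuloDeRham.Birth

end Summit.Langlands.Langlands.Theses.HeckeFieldDeRham
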